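import Literature.Geometry.DiscreteGeometry.GegenbauerFourPSD

/-!
# Three-point (Bachoc–Vallentin) positivity on `S³` with the Chebyshev kernel — part A

Step 1 of the semidefinite (three-point) bound for the kissing number in four dimensions:
the kernels `Q_k(u,v,t) = h_k(2(t - uv), (1 - u²)(1 - v²))` (Bachoc–Vallentin 2008, §3,
with the `S²`-zonal kernel taken to be the restriction of the `S³` kernel `U_k`, which is positive
definite on every subspace) are positive semidefinite "around" any fixed unit vector `z`:
`Σ_{i,j} c_i c_j Q_k(z·p_i, z·p_j, p_i·p_j) ≥ 0` for unit vectors `p_i ∈ ℝ⁴`.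
Proof: `Q_k(z·x, z·y, x·y) = h_k(2⟨w_x, w_y⟩, ‖w_x‖²‖w_y‖²)` for the projections
`w_x = x - (z·x) z` onto `z^⊥`, and `sum_sum_chebUh_nonneg`.

## References
* C. Bachoc, F. Vallentin, *New upper bounds for kissing numbers from semidefinite programming*,
  J. Amer. Math. Soc. 21 (2008) 909–924, §3 (Thm 3.2, Cor 3.5, Rem 3.4). [`BachocVallentin2007`]
* O. R. Musin, *The kissing number in four dimensions*, Ann. of Math. 168 (2008), §3. [`Musin2008`]
-/

noncomputable section

open scoped RealInnerProductSpace

namespace Literature.Geometry.DiscreteGeometry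

/-- Local notation for `ℝ⁴ = EuclideanSpace ℝ (Fin 4)`. -/
local notation "E⁴" => EuclideanSpace ℝ (Fin 4)

/-- The three-point kernel `Q_k(u,v,t) = h_k(2(t - uv), (1-u²)(1-v²))` (Bachoc–Vallentin's `Q_k`
with the Chebyshev kernel of the second kind). [cite: BachocVallentin2007, Theorem 3.2] -/
def Qk (k : ℕ) (u v t : ℝ) : ℝ := chebUh k (2 * (t - u * v)) ((1 - u ^ 2) * (1 - v ^ 2))

/-- Projection of `x` to the orthogonal complement of the unit vector `z`. [folklore] -/
def wproj (z x : E⁴) : E⁴ := x - (inner ℝ z x) • z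

/-- `⟨w_x, w_y⟩ = x·y - (z·x)(z·y)` for a unit vector `z`. [folklore] -/
theorem inner_wproj (z x y : E⁴) (hz : ‖z‖ = 1) :
    inner ℝ (wproj z x) (wproj z y) = inner ℝ x y - inner ℝ z x * inner ℝ z y := by
  have hzz : inner ℝ z z = (1 : ℝ) := by
    rw [real_inner_self_eq_norm_sq, hz]; norm_num
  simp only [wproj, inner_sub_left, inner_sub_right, real_inner_smul_left, real_inner_smul_right,
    hzz]
  rw [real_inner_comm z x]
  ring

/-- `‖w_x‖² = 1 - (z·x)²` for unit vectors `z, x`. [folklore] -/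
theorem norm_sq_wproj (z x : E⁴) (hz : ‖z‖ = 1) (hx : ‖x‖ = 1) :
    ‖wproj z x‖ ^ 2 = 1 - inner ℝ z x ^ 2 := by
  rw [← real_inner_self_eq_norm_sq, inner_wproj z x x hz, real_inner_self_eq_norm_sq, hx]
  ring

/-- `Q_k(z·x, z·y, x·y) = h_k(2⟨w_x,w_y⟩, ‖w_x‖²‖w_y‖²)`. [cite: BachocVallentin2007, Theorem 3.2] -/
theorem Qk_inner_eq (k : ℕ) (z x y : E⁴) (hz : ‖z‖ = 1) (hx : ‖x‖ = 1) (hy : ‖y‖ = 1) :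
    Qk k (inner ℝ z x) (inner ℝ z y) (inner ℝ x y) =
      chebUh k (2 * inner ℝ (wproj z x) (wproj z y)) (‖wproj z x‖ ^ 2 * ‖wproj z y‖ ^ 2) := by
  rw [Qk, inner_wproj z x y hz, norm_sq_wproj z x hz hx, norm_sq_wproj z y hz hy]

/-- **Positivity of the three-point kernel around a fixed point** (Bachoc–Vallentin 2008,
Thm 3.1(d)/Cor 3.5, here for the Chebyshev kernel, degrees `k ≤ 9`): for a unit vector `z`, unit
vectors `p_i` and real weights `c_i`, `Σ_{i,j} c_i c_j Q_k(z·p_i, z·p_j, p_i·p_j) ≥ 0`.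
[cite: BachocVallentin2007, Corollary 3.5] -/
theorem sum_sum_Qk_nonneg (k : ℕ) (hk : k ≤ 9) (z : E⁴) (hz : ‖z‖ = 1) {ι : Type*}
    (s : Finset ι) (c : ι → ℝ) (p : ι → E⁴) (hp : ∀ i ∈ s, ‖p i‖ = 1) :
    0 ≤ ∑ i ∈ s, ∑ j ∈ s,
      c i * c j * Qk k (inner ℝ z (p i)) (inner ℝ z (p j)) (inner ℝ (p i) (p j)) := by
  have h := sum_sum_chebUh_nonneg k hk s c (fun i => wproj z (p i))
  have heq : ∀ i ∈ s, ∀ j ∈ s,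
      c i * c j * chebUh k (2 * inner ℝ (wproj z (p i)) (wproj z (p j)))
        (‖wproj z (p i)‖ ^ 2 * ‖wproj z (p j)‖ ^ 2) =
      c i * c j * Qk k (inner ℝ z (p i)) (inner ℝ z (p j)) (inner ℝ (p i) (p j)) := by
    intro i hi j hj
    rw [Qk_inner_eq k z (p i) (p j) hz (hp i hi) (hp j hj)]
  rwa [Finset.sum_congr rfl fun i hi => Finset.sum_congr rfl fun j hj => heq i hi j hj] at h

/-- Polynomial weight `φ_w(u) = Σ_a w_a u^a`. [folklore] -/
def polyW (w : List ℝ) (u : ℝ) : ℝ := (w.zipIdx.map fun ac : ℝ × ℕ => ac.1 * u ^ ac.2).sum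

/-- The `Y`-form of Bachoc–Vallentin for a weight vector `w`:
`Y_{k,w}(u,v,t) = φ_w(u) φ_w(v) Q_k(u,v,t)` (i.e. `wᵀ Y_k(u,v,t) w` with `(Y_k)_{ab} = u^a v^b Q_k`).
[cite: BachocVallentin2007, Theorem 3.2 and Remark 3.4] -/
def Yform (k : ℕ) (w : List ℝ) (u v t : ℝ) : ℝ := polyW w u * polyW w v * Qk k u v t

/-- **Three-point positivity** (Bachoc–Vallentin 2008, (pos S) / Corollary 3.5):
`Σ_{x,y,z ∈ C} wᵀ Y_k(z·x, z·y, x·y) w ≥ 0` for a finite set `C` of unit vectors.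
[cite: BachocVallentin2007, Corollary 3.5] -/
theorem sum3_Yform_nonneg (k : ℕ) (hk : k ≤ 9) (w : List ℝ) (C : Finset E⁴)
    (hC : ∀ x ∈ C, ‖x‖ = 1) :
    0 ≤ ∑ z ∈ C, ∑ x ∈ C, ∑ y ∈ C, Yform k w (inner ℝ z x) (inner ℝ z y) (inner ℝ x y) := by
  refine Finset.sum_nonneg fun z hz => ?_
  have h := sum_sum_Qk_nonneg k hk z (hC z hz) C (fun x => polyW w (inner ℝ z x)) (fun x => x) hC
  simpa only [Yform] using h

end Literature.Geometry.DiscreteGeometry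

end
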